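import Literature.AnabelianGeometry.EtaleTheta.SettingModelThetaEigenStatements
import Literature.AnabelianGeometry.EtaleTheta.SettingModelCyclotomicCharacterInvariants
import Literature.AnabelianGeometry.EtaleTheta.SettingModelConjugacyCompactness
import Literature.IUT.HodgeTheaters.ProfiniteCompletionFiniteIndexIso
import Literature.AnabelianGeometry.EtaleTheta.ZHatLevelDetermination
import Literature.AnabelianGeometry.AbsoluteAnabelian.AbsTopII.DehnTwistFreeGroupInputs
import Mathlib.GroupTheory.SemidirectProduct
import Literature.AnabelianGeometry.EtaleTheta.FreeProfinitePermBasis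
import HarnessLib

/-!
# The b-torsion tower of `F̂₂` — objects (ROUTE-PBF file T0-D)

DEFINITIONS (definition lane) for PL3-TREEFREE §1: the discrete level group `Λ_n := FreeGroup (ZMod n) ⋊ C_n`, its
profinite completion `Q_n`, `φ_n : F̂₂ → Q_n` (`a ↦ x_0`, `b ↦ c`), the affine endomorphisms `k_{u,β}` and their
completions `k̂_{u,β}`, the pieces `rotPart/letterPart/lamPart/rho` of a finite quotient, the sets `W_n`, the letters subgroup `Glet`, `N̂`, `ι_n`, `affPerm`, `χ_n(σ)` as a unit,
and the level maps `F̂₂ → F₂/M`.  No instance, no notation; rfl-level lemmas only.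
Classical profinite group theory about OUR semi-synthetic `F₂hatT`; CONDITIONAL (where stated) on the displayed
tree-free hypothesis `PermBasisFixedPoints`; nothing about [EtTh]/[IUTchII]/[IUTchIII] in print; no side on
[IUTchIII] Cor 3.12; nothing here asserts abc proved or refuted.  abc-iut-L6-t19 gen 22 (ROUTE-PBF, rung (L3′) slice 1).
-/

noncomputable section

namespace Literature.AnabelianGeometry.EtaleTheta.SettingModel.BTorsionTower

open Literature.AnabelianGeometry.EtaleTheta.SettingModel
open Literature.AnabelianGeometry.EtaleTheta (ZHatLevel.level ZHatLevel.levelChar)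
open Literature.AnabelianGeometry.SemiGraphs
open Literature.AnabelianGeometry.AbsoluteAnabelian
open Literature.IUT.HodgeTheaters (profiniteCompletion toCompletion)
open CategoryTheory
open Literature.AnabelianGeometry.EtaleTheta.SettingModel.TreeFree (permHat PermBasisFixedPoints permHat_toCompletion)

variable (n : ℕ+)

/-! ### The discrete level group `Λ_n = FreeGroup (ZMod n) ⋊ C_n` -/

/-- The rotation of the letters by `j`: `x_i ↦ x_{i+j}`, as an automorphism of `FreeGroup (ZMod n)`. [cite: MochizukiEtTh2009, §1 p.12] -/
def rotAut (j : ZMod n) : MulAut (FreeGroup (ZMod n)) := FreeGroup.freeGroupCongr (Equiv.addRight j)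

/-- The rotation by `j` sends the letter `x_i` to `x_{i+j}`. [cite: MochizukiEtTh2009, §1 p.12] -/
@[simp] theorem rotAut_of (j i : ZMod n) : rotAut n j (FreeGroup.of i) = FreeGroup.of (i + j) := by
  simp [rotAut, FreeGroup.freeGroupCongr_apply]

/-- `C_n = Multiplicative (ZMod n)` acting on `FreeGroup (ZMod n)` by rotating the letters. [cite: MochizukiEtTh2009, §1 p.12] -/
def rot : Multiplicative (ZMod n) →* MulAut (FreeGroup (ZMod n)) where
  toFun c := rotAut n (Multiplicative.toAdd c)
  map_one' := by
    apply MulEquiv.toMonoidHom_injective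
    refine FreeGroup.ext_hom _ _ fun i => ?_
    simp
  map_mul' a b := by
    apply MulEquiv.toMonoidHom_injective
    refine FreeGroup.ext_hom _ _ fun i => ?_
    simp only [toAdd_mul, MulEquiv.coe_toMonoidHom, MulAut.mul_apply, rotAut_of]
    congr 1
    abel

/-- `rot c (x_i) = x_{i + c}`. [cite: MochizukiEtTh2009, §1 p.12] -/
@[simp] theorem rot_apply_of (c : Multiplicative (ZMod n)) (i : ZMod n) :
    rot n c (FreeGroup.of i) = FreeGroup.of (i + Multiplicative.toAdd c) := rotAut_of n _ i

/-- The level-`n` discrete group `Λ_n := FreeGroup (ZMod n) ⋊ C_n`. [cite: MochizukiEtTh2009, §1 p.12] -/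
abbrev Lam : Type := FreeGroup (ZMod n) ⋊[rot n] Multiplicative (ZMod n)

/-- The letter `x_i ∈ Λ_n`. [cite: MochizukiEtTh2009, §1 p.12] -/
abbrev xL (i : ZMod n) : Lam n := SemidirectProduct.inl (FreeGroup.of i)

/-- The rotation generator `c ∈ Λ_n`. [cite: MochizukiEtTh2009, §1 p.12] -/
abbrev cL : Lam n := SemidirectProduct.inr (Multiplicative.ofAdd (1 : ZMod n))

/-- `c^j = inr (j)` in `Λ_n`. [cite: MochizukiEtTh2009, §1 p.12] -/
theorem cL_pow (j : ℕ) : cL n ^ j = SemidirectProduct.inr (Multiplicative.ofAdd (j : ZMod n)) := by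
  rw [cL, ← map_pow, ← ofAdd_nsmul, nsmul_eq_mul, mul_one]

/-- Conjugation by `c^j` rotates the letters: `c^j x_i c^{-j} = x_{i+j}`. [cite: MochizukiEtTh2009, §1 p.12] -/
theorem conj_xL (j : ZMod n) (i : ZMod n) :
    SemidirectProduct.inr (Multiplicative.ofAdd j) * xL n i * (SemidirectProduct.inr (Multiplicative.ofAdd j))⁻¹
      = xL n (i + j) := by
  rw [xL, xL, ← map_inv, ← SemidirectProduct.inl_aut, rot_apply_of, toAdd_ofAdd]

/-- `f_n : F₂ → Λ_n`, `x₀ ↦ x_0`, `x₁ ↦ c`. [cite: MochizukiEtTh2009, §1 p.12] -/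
def fLam : F₂ →* Lam n := FreeGroup.lift ![xL n 0, cL n]

/-- `F₂ → Λ_n` sends `a = x₀` to the letter `x_0`. [cite: MochizukiEtTh2009, §1 p.12] -/
@[simp] theorem fLam_of_zero : fLam n (FreeGroup.of 0) = xL n 0 := by simp [fLam]
/-- `F₂ → Λ_n` sends `b = x₁` to the rotation `c`. [cite: MochizukiEtTh2009, §1 p.12] -/
@[simp] theorem fLam_of_one : fLam n (FreeGroup.of 1) = cL n := by simp [fLam]

/-! ### The completion `Q_n` and `φ_n : F̂₂ → Q_n` -/

/-- `Q_n := Λ̂_n`, the profinite completion (a `ProfiniteGrp`). [cite: MochizukiEtTh2009, §1 p.12] -/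
abbrev Q : ProfiniteGrp.{0} := profiniteCompletion (Lam n)

/-- `η_Λ : Λ_n → Q_n`. [cite: MochizukiEtTh2009, §1 p.12] -/
abbrev etaL : Lam n →* Q n := toCompletion (Lam n)

/-- **`φ_n : F̂₂ → Q_n`**, the continuous extension of `η_Λ ∘ f_n`. [cite: MochizukiEtTh2009, §1 p.12] -/
def phi : F₂hatT →ₜ* Q n :=
  (ProfiniteGrp.ProfiniteCompletion.lift (GrpCat.ofHom ((etaL n).comp (fLam n)))).hom

/-- `φ_n ∘ η = η_Λ ∘ (F₂ → Λ_n)`. [cite: MochizukiEtTh2009, §1 p.12] -/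
theorem phi_eta (g : F₂) : phi n (eta g) = etaL n (fLam n g) :=
  lift_hom_toCompletion (Q n) ((etaL n).comp (fLam n)) g

/-- `φ_n(a) = x_0`. [cite: MochizukiEtTh2009, §1 p.12] -/
theorem phi_eta_zero : phi n (eta (FreeGroup.of 0)) = etaL n (xL n 0) := by
  rw [phi_eta, fLam_of_zero]

/-- `φ_n(b) = c`. [cite: MochizukiEtTh2009, §1 p.12] -/
theorem phi_eta_one : phi n (eta (FreeGroup.of 1)) = etaL n (cL n) := by
  rw [phi_eta, fLam_of_one]


/-! ### The affine endomorphisms `k_{u,β} : x_i ↦ x_{u i + β}`, `c ↦ c^u` of `Λ_n` and of `Q_n` -/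

/-- On letters: `i ↦ u·i + β`. [cite: MochizukiEtTh2009, §1 p.12] -/
def affLetters (u β : ZMod n) : FreeGroup (ZMod n) →* FreeGroup (ZMod n) := FreeGroup.map fun i => u * i + β

/-- `k_{u,β}` on letters: `x_i ↦ x_{u i + β}`. [cite: MochizukiEtTh2009, §1 p.12] -/
@[simp] theorem affLetters_of (u β i : ZMod n) : affLetters n u β (FreeGroup.of i) = FreeGroup.of (u * i + β) := by
  simp [affLetters]

/-- On `C_n`: `c^j ↦ c^{u j}`. [cite: MochizukiEtTh2009, §1 p.12] -/
def affRot (u : ZMod n) : Multiplicative (ZMod n) →* Multiplicative (ZMod n) :=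
  (AddMonoidHom.mulLeft u).toMultiplicative

/-- `k_{u,β}` on the rotation group: `c ↦ c^u`. [cite: MochizukiEtTh2009, §1 p.12] -/
@[simp] theorem affRot_apply (u : ZMod n) (c : Multiplicative (ZMod n)) :
    affRot n u c = Multiplicative.ofAdd (u * Multiplicative.toAdd c) := rfl

/-- **`k_{u,β} : Λ_n → Λ_n`** (`x_i ↦ x_{u i+β}`, `c ↦ c^u`). [cite: MochizukiEtTh2009, §1 p.12] -/
def aff (u β : ZMod n) : Lam n →* Lam n :=
  SemidirectProduct.map (affLetters n u β) (affRot n u) (fun c => by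
    refine FreeGroup.ext_hom _ _ fun i => ?_
    simp only [MonoidHom.coe_comp, MulEquiv.coe_toMonoidHom, Function.comp_apply, rot_apply_of,
      affLetters_of, affRot_apply, toAdd_ofAdd]
    congr 1
    ring)

/-- `k_{u,β}(x_i) = x_{u i + β}` in `Λ_n`. [cite: MochizukiEtTh2009, §1 p.12] -/
@[simp] theorem aff_xL (u β i : ZMod n) : aff n u β (xL n i) = xL n (u * i + β) := by
  ext <;> simp [aff, xL]

/-- `k_{u,β}(c) = c^u` in `Λ_n`. [cite: MochizukiEtTh2009, §1 p.12] -/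
@[simp] theorem aff_inr (u β : ZMod n) (c : Multiplicative (ZMod n)) :
    aff n u β (SemidirectProduct.inr c) = SemidirectProduct.inr (affRot n u c) := by
  ext <;> simp [aff]

/-- **`k̂_{u,β} : Q_n → Q_n`**, the completion of `k_{u,β}`. [cite: MochizukiEtTh2009, §1 p.12] -/
def affHat (u β : ZMod n) : Q n →ₜ* Q n :=
  (ProfiniteGrp.profiniteCompletion.map (GrpCat.ofHom (aff n u β))).hom

/-- `k̂_{u,β} ∘ η_Λ = η_Λ ∘ k_{u,β}`. [cite: MochizukiEtTh2009, §1 p.12] -/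
theorem affHat_etaL (u β : ZMod n) (g : Lam n) : affHat n u β (etaL n g) = etaL n (aff n u β g) :=
  Literature.IUT.HodgeTheaters.ProfiniteCompletion.profiniteCompletionMap_toCompletion (aff n u β) g


/-! ### The level-`n` pieces of a finite quotient `ψ` with `ψ(b)^n = 1` -/

section Factor

variable {P : ProfiniteGrp.{0}}

/-- `c^j ↦ ψ(b)^j` on `C_n` (well defined since `ψ(b)^n = 1`). [cite: MochizukiEtTh2009, §1 p.12] -/
def rotPart (ψ : F₂hatT →ₜ* P) (hψ : ψ (eta (FreeGroup.of 1)) ^ (n : ℕ) = 1) :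
    Multiplicative (ZMod n) →* P :=
  AddMonoidHom.toMultiplicativeLeft
    (ZMod.lift n ⟨zmultiplesHom (Additive P) (Additive.ofMul (ψ (eta (FreeGroup.of 1)))), by
      rw [zmultiplesHom_apply]
      change ((n : ℕ) : ℤ) • Additive.ofMul (ψ (eta (FreeGroup.of 1))) = 0
      rw [natCast_zsmul, ← ofMul_pow, hψ, ofMul_one]⟩)

/-- `rotPart` on the class of an integer `k` is `ψ(b)^k`. [cite: MochizukiEtTh2009, §1 p.12] -/
theorem rotPart_ofAdd_intCast (ψ : F₂hatT →ₜ* P) (hψ : ψ (eta (FreeGroup.of 1)) ^ (n : ℕ) = 1) (k : ℤ) :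
    rotPart n ψ hψ (Multiplicative.ofAdd (k : ZMod n)) = ψ (eta (FreeGroup.of 1)) ^ k := by
  change Additive.toMul (ZMod.lift n ⟨zmultiplesHom (Additive P) _, _⟩ (k : ZMod n)) = _
  rw [ZMod.lift_coe]
  change Additive.toMul (k • Additive.ofMul (ψ (eta (FreeGroup.of 1)))) = _
  rw [← ofMul_zpow, toMul_ofMul]

/-- `rotPart (1) = ψ(b)`. [cite: MochizukiEtTh2009, §1 p.12] -/
theorem rotPart_ofAdd_one (ψ : F₂hatT →ₜ* P) (hψ : ψ (eta (FreeGroup.of 1)) ^ (n : ℕ) = 1) :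
    rotPart n ψ hψ (Multiplicative.ofAdd 1) = ψ (eta (FreeGroup.of 1)) := by
  have h := rotPart_ofAdd_intCast n ψ hψ 1
  rwa [Int.cast_one, zpow_one] at h

/-- `x_i ↦ ψ(b)^i ψ(a) ψ(b)^{-i}` on the letters. [cite: MochizukiEtTh2009, §1 p.12] -/
def letterPart (ψ : F₂hatT →ₜ* P) (hψ : ψ (eta (FreeGroup.of 1)) ^ (n : ℕ) = 1) :
    FreeGroup (ZMod n) →* P :=
  FreeGroup.lift fun i =>
    rotPart n ψ hψ (Multiplicative.ofAdd i) * ψ (eta (FreeGroup.of 0)) * (rotPart n ψ hψ (Multiplicative.ofAdd i))⁻¹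

/-- `letterPart (x_i) = ψ(b)^i ψ(a) ψ(b)^{-i}`. [cite: MochizukiEtTh2009, §1 p.12] -/
theorem letterPart_of (ψ : F₂hatT →ₜ* P) (hψ : ψ (eta (FreeGroup.of 1)) ^ (n : ℕ) = 1) (i : ZMod n) :
    letterPart n ψ hψ (FreeGroup.of i) =
      rotPart n ψ hψ (Multiplicative.ofAdd i) * ψ (eta (FreeGroup.of 0)) *
        (rotPart n ψ hψ (Multiplicative.ofAdd i))⁻¹ := by
  rw [letterPart, FreeGroup.lift_apply_of]

/-- `r : Λ_n → P`, `x_i ↦ ψ(b)^i ψ(a) ψ(b)^{-i}`, `c ↦ ψ(b)`. [cite: MochizukiEtTh2009, §1 p.12] -/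
def lamPart (ψ : F₂hatT →ₜ* P) (hψ : ψ (eta (FreeGroup.of 1)) ^ (n : ℕ) = 1) : Lam n →* P :=
  SemidirectProduct.lift (letterPart n ψ hψ) (rotPart n ψ hψ) (fun c => by
    refine FreeGroup.ext_hom _ _ fun i => ?_
    simp only [MonoidHom.coe_comp, MulEquiv.coe_toMonoidHom, Function.comp_apply, rot_apply_of,
      letterPart_of, MulAut.conj_apply]
    rw [ofAdd_add, ofAdd_toAdd, mul_comm (Multiplicative.ofAdd i) c, map_mul]
    group)

/-- `lamPart (x_i) = ψ(b)^i ψ(a) ψ(b)^{-i}`. [cite: MochizukiEtTh2009, §1 p.12] -/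
theorem lamPart_xL (ψ : F₂hatT →ₜ* P) (hψ : ψ (eta (FreeGroup.of 1)) ^ (n : ℕ) = 1) (i : ZMod n) :
    lamPart n ψ hψ (xL n i) = rotPart n ψ hψ (Multiplicative.ofAdd i) * ψ (eta (FreeGroup.of 0)) *
        (rotPart n ψ hψ (Multiplicative.ofAdd i))⁻¹ := by
  rw [lamPart, SemidirectProduct.lift_inl, letterPart_of]

/-- `lamPart (c) = rotPart (c)`. [cite: MochizukiEtTh2009, §1 p.12] -/
theorem lamPart_inr (ψ : F₂hatT →ₜ* P) (hψ : ψ (eta (FreeGroup.of 1)) ^ (n : ℕ) = 1)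
    (c : Multiplicative (ZMod n)) :
    lamPart n ψ hψ (SemidirectProduct.inr c) = rotPart n ψ hψ c := by
  rw [lamPart, SemidirectProduct.lift_inr]

/-- **`ρ : Q_n → P`**, the continuous extension of `r`. [cite: MochizukiEtTh2009, §1 p.12] -/
def rho (ψ : F₂hatT →ₜ* P) (hψ : ψ (eta (FreeGroup.of 1)) ^ (n : ℕ) = 1) : Q n →ₜ* P :=
  (ProfiniteGrp.ProfiniteCompletion.lift (GrpCat.ofHom (lamPart n ψ hψ))).hom

/-- `ρ ∘ η_Λ = lamPart`. [cite: MochizukiEtTh2009, §1 p.12] -/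
theorem rho_etaL (ψ : F₂hatT →ₜ* P) (hψ : ψ (eta (FreeGroup.of 1)) ^ (n : ℕ) = 1) (g : Lam n) :
    rho n ψ hψ (etaL n g) = lamPart n ψ hψ g :=
  lift_hom_toCompletion P (lamPart n ψ hψ) g

end Factor


/-! ### The sets `W_n(U)` of (L2) -/

section Adapted

variable (p : ℕ) [Fact p.Prime] (U : Subgroup (GQp p))

/-- `W_n(U) := {z ∈ Ẑ : χ(σ)z ≡ z (mod n) for all σ ∈ U}`. [cite: MochizukiEtTh2009, §1 p.12] -/
def Wset (n : ℕ+) : Set ZH := {z | ∀ σ ∈ U, ZHatLevel.level n (chi p σ z * z⁻¹) = 1}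

end Adapted



section TowerObjects

variable (n : ℕ+)

/-- The letters subgroup `inl(FreeGroup) ≤ Λ_n`. [cite: MochizukiEtTh2009, §1 p.12] -/
abbrev Glet : Subgroup (Lam n) := (SemidirectProduct.inl : FreeGroup (ZMod n) →* Lam n).range

/-- `inl(FreeGroup)` has finite index `n` in `Λ_n`. [cite: MochizukiEtTh2009, §1 p.12] -/
theorem finiteIndex_Glet : (Glet n).FiniteIndex := by
  haveI : Finite (Lam n ⧸ Glet n) := by
    rw [Glet, SemidirectProduct.range_inl_eq_ker_rightHom]
    exact Finite.of_equiv _ (QuotientGroup.quotientKerEquivOfSurjective _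
      SemidirectProduct.rightHom_surjective).symm.toEquiv
  exact Subgroup.finiteIndex_of_finite_quotient

/-- `N̂ := closure(η_Λ(inl FreeGroup)) ⊆ Q_n`. [cite: MochizukiEtTh2009, §1 p.12] -/
abbrev Nhat : Set (Q n) := closure (etaL n '' (Glet n : Set (Lam n)))

/-- `ι_n : F̂(ZMod n) → Q_n`, the completion of `inl`. [cite: MochizukiEtTh2009, §1 p.12] -/
def iota : profiniteCompletion (FreeGroup (ZMod n)) →ₜ* Q n :=
  (ProfiniteGrp.profiniteCompletion.map
    (GrpCat.ofHom (SemidirectProduct.inl : FreeGroup (ZMod n) →* Lam n))).hom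

/-- `ι_n ∘ η = η_Λ ∘ inl`. [cite: MochizukiEtTh2009, §1 p.12] -/
theorem iota_toCompletion (g : FreeGroup (ZMod n)) :
    iota n (toCompletion (FreeGroup (ZMod n)) g) = etaL n (SemidirectProduct.inl g) :=
  Literature.IUT.HodgeTheaters.ProfiniteCompletion.profiniteCompletionMap_toCompletion _ g

/-- The affine permutation `i ↦ u·i + β` for a unit `u`. [cite: MochizukiEtTh2009, §1 p.12] -/
def affPerm (u : (ZMod n)ˣ) (β : ZMod n) : Equiv.Perm (ZMod n) where
  toFun i := (u : ZMod n) * i + β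
  invFun i := (u⁻¹ : (ZMod n)ˣ) * (i - β)
  left_inv i := by simp
  right_inv i := by simp

/-- `affPerm u β i = u i + β`. [cite: MochizukiEtTh2009, §1 p.12] -/
@[simp] theorem affPerm_apply (u : (ZMod n)ˣ) (β i : ZMod n) : affPerm n u β i = (u : ZMod n) * i + β := rfl

/-- `N̂` as a subgroup of `Q_n`. [cite: MochizukiEtTh2009, §1 p.12] -/
abbrev NhatSub : Subgroup (Q n) := ((Glet n).map (etaL n)).topologicalClosure

/-- The underlying set of `N̂` is the closure of `η_Λ(inl FreeGroup)`. [cite: MochizukiEtTh2009, §1 p.12] -/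
theorem coe_NhatSub : (NhatSub n : Set (Q n)) = Nhat n := by
  rw [NhatSub, Subgroup.topologicalClosure_coe, Subgroup.coe_map]

end TowerObjects

section LevelObjects

variable (p : ℕ) [Fact p.Prime]

/-- `χ_n(σ)` as a unit of `ℤ/n`. [cite: MochizukiEtTh2009, §1 p.12] -/
def chiUnit (n : ℕ+) (σ : GQp p) : (ZMod n)ˣ :=
  Units.mkOfMulEqOne _ _ (ZHatLevel.levelChar_mul_levelChar_inv n (chi p σ))

/-- The unit `χ_n(σ)` has value `levelChar n (χ σ)`. [cite: MochizukiEtTh2009, §1 p.12] -/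
@[simp] theorem coe_chiUnit (n : ℕ+) (σ : GQp p) :
    (chiUnit p n σ : ZMod n) = ZHatLevel.levelChar n (chi p σ) := rfl

/-- The level-`M` quotient map `F̂₂ → F₂/M` as a continuous homomorphism into the (finite, discrete)
profinite group `F₂/M`. [cite: MochizukiEtTh2009, §1 p.12] -/
def levelMap (M : FiniteIndexNormalSubgroup F₂) :
    F₂hatT →ₜ* (ProfiniteGrp.ProfiniteCompletion.diagram (GrpCat.of F₂)).obj M where
  toMonoidHom := MonoidHom.mk' (fun x : F₂hatT => x.val M) (fun _ _ => rfl)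
  continuous_toFun := Literature.IUT.HodgeTheaters.ProfiniteCompletion.continuous_val M

/-- The level map on `η(g)` is the class of `g`. [cite: MochizukiEtTh2009, §1 p.12] -/
theorem levelMap_eta (M : FiniteIndexNormalSubgroup F₂) (g : F₂) :
    levelMap M (eta g) = (QuotientGroup.mk g : F₂ ⧸ M.toSubgroup) := rfl

end LevelObjects

end Literature.AnabelianGeometry.EtaleTheta.SettingModel.BTorsionTower

end
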